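import Mathlib
import Summits.Ventures.PercRepro2.Defs
import Summits.Ventures.PercRepro2.Graph
import Summits.Ventures.PercRepro2.Events
import Summits.Ventures.PercRepro2.Harris
import Summits.Ventures.PercRepro2.XWKTwoFourTab

/-!
# (XW) on `K_{2,4}`: the integer antipodal forms, the sub-mask sums and the decided certificate
(PercRepro2, p2 g25)

On top of `XWKTwoFourTab.lean` (the graph, its Boolean connectivity, the bit encodings): the
integer forms `xwZ` / `xwT` / `xwAntiZ` of `B_W` at point masses, the antipodal sum `W` at a bit
pattern and a mask, its rewriting as the fibre-weighted sub-mask sum `Wsub` (every fibre of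
`j ↦ j &&& m` over a sub-mask of `m` has the size `fib0 m` of the fibre of `0`: `card_fibre`),
the decided statement **`sums_all`** (every antipodal coefficient of `K_{2,4}` at the placement
`0, 1, 2, 3` is nonnegative — the `3^8 = 6561` cells and their `4^8` colouring pairs in one
kernel `decide`, `≈ 110 s`) and **`xwAntiZ_nonneg`**.  Modelled on XWKFiveSub.lean (p2 g24);
own work; standard axioms.
-/

namespace Summit.Ventures.PercRepro2

namespace XWKTwoFour

/-! ## The integer forms -/

/-- The indicator of a Boolean, in `ℤ`. -/
def indZ (b : Bool) : ℤ := if b then 1 else 0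

/-- `B_W(X, Y)` at two point masses, in `ℤ`. -/
def xwZ (s y o u : Fin 6) (X Y : Config (Fin 8)) : ℤ :=
  indZ (connB X s u && connB X y o) +
    indZ (connB X s y && connB X s u) * indZ (connB Y s y && connB Y y o) -
    indZ (connB X s u) * indZ (connB Y y o) -
    indZ (connB X s y) * indZ (connB Y s y && connB Y s u && connB Y y o)

/-- `B_W` at two bit patterns, in `ℤ`, through the formula. -/
def xwT (s y o u : Fin 6) (X Y : ℕ) : ℤ :=
  indZ (tabBit X s u && tabBit X y o) +
    indZ (tabBit X s y && tabBit X s u) * indZ (tabBit Y s y && tabBit Y y o) -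
    indZ (tabBit X s u) * indZ (tabBit Y y o) -
    indZ (tabBit X s y) * indZ (tabBit Y s y && tabBit Y s u && tabBit Y y o)

/-- `xwZ` at bit patterns is `xwT`. -/
lemma xwZ_cfg (s y o u : Fin 6) {X Y : ℕ} (hX : X < 256) (hY : Y < 256) :
    xwZ s y o u (cfg X) (cfg Y) = xwT s y o u X Y := by
  simp only [xwZ, xwT, connB, enc_cfg X hX, enc_cfg Y hY]

/-- The configuration `ζ` overwritten by `η` on `F`. -/
def mix (ζ : Config (Fin 8)) (F : Finset (Fin 8)) (η : Config (Fin 8)) : Config (Fin 8) :=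
  fun e => if e ∈ F then η e else ζ e

/-- The antipodal coefficient at the point mass `ζ` on the free edges `F`, in `ℤ`. -/
def xwAntiZ (s y o u : Fin 6) (ζ : Config (Fin 8)) (F : Finset (Fin 8)) : ℤ :=
  ∑ η : Config (Fin 8), xwZ s y o u (mix ζ F η) (mix ζ F (fun e => !η e))

/-- `mix` through the mask. -/
def mixM (ζ : Config (Fin 8)) (m : ℕ) (η : Config (Fin 8)) : Config (Fin 8) :=
  fun e => if m.testBit e.val then η e else ζ e

/-- `mix` is `mixM` at the mask of `F`. -/
lemma mix_eq_mixM (ζ : Config (Fin 8)) (F : Finset (Fin 8)) (η : Config (Fin 8)) :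
    mix ζ F η = mixM ζ (maskOf F) η := by
  funext e
  simp only [mix, mixM, mem_iff_testBit F e]

/-- The antipodal coefficient at the point mass `cfg k` on the mask `m`, summed over the bit
patterns of the colourings. -/
def W (s y o u : Fin 6) (k m : ℕ) : ℤ :=
  ∑ j : Fin 256, xwZ s y o u (mixM (cfg k) m (cfg j.val)) (mixM (cfg k) m (fun e => !cfg j.val e))

/-- `xwAntiZ` is `W` at the encodings. -/
lemma xwAntiZ_eq_W (s y o u : Fin 6) (ζ : Config (Fin 8)) (F : Finset (Fin 8)) :
    xwAntiZ s y o u ζ F = W s y o u (enc ζ) (maskOf F) := by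
  unfold xwAntiZ W
  rw [← Fintype.sum_equiv cfgEquiv
      (fun k => xwZ s y o u (mixM (cfg (enc ζ)) (maskOf F) (cfg k.val))
        (mixM (cfg (enc ζ)) (maskOf F) (fun e => !cfg k.val e)))
      (fun η => xwZ s y o u (mix ζ F η) (mix ζ F (fun e => !η e))) (fun k => ?_)]
  simp only [cfgEquiv, Equiv.coe_fn_mk, cfg_enc, mix_eq_mixM]

/-- `mix` does not see `ζ` on `F`. -/
lemma mix_eq_mix_erase (ζ : Config (Fin 8)) (F : Finset (Fin 8)) (η : Config (Fin 8)) :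
    mix ζ F η = mix (fun e => if e ∈ F then false else ζ e) F η := by
  funext e
  by_cases he : e ∈ F <;> simp [mix, he]

/-- `xwAntiZ` does not see `ζ` on `F`. -/
lemma xwAntiZ_eq_erase (s y o u : Fin 6) (ζ : Config (Fin 8)) (F : Finset (Fin 8)) :
    xwAntiZ s y o u ζ F = xwAntiZ s y o u (fun e => if e ∈ F then false else ζ e) F := by
  unfold xwAntiZ
  refine Finset.sum_congr rfl fun η _ => ?_
  rw [mix_eq_mix_erase ζ F η, mix_eq_mix_erase ζ F (fun e => !η e)]

/-- The encoding of a configuration cleared on `F` has no bit on the mask of `F`. -/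
lemma enc_erase_land (ζ : Config (Fin 8)) (F : Finset (Fin 8)) :
    enc (fun e => if e ∈ F then false else ζ e) &&& maskOf F = 0 := by
  apply Nat.eq_of_testBit_eq
  intro i
  rw [Nat.testBit_and, Nat.zero_testBit]
  by_cases hi : i < 8
  · have h1 := testBit_enc (fun e => if e ∈ F then false else ζ e) ⟨i, hi⟩
    have h2 := (mem_iff_testBit F ⟨i, hi⟩)
    simp only at h1
    rw [h1]
    by_cases hF : (⟨i, hi⟩ : Fin 8) ∈ F
    · rw [if_pos hF]
      simp
    · have : (maskOf F).testBit i = false := by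
        rw [← Bool.not_eq_true]
        exact fun h => hF (h2.2 h)
      rw [this]
      simp
  · have h2 : (2 : ℕ) ^ 8 ≤ 2 ^ i := Nat.pow_le_pow_right (by norm_num) (by omega)
    have h1 : (enc fun e => if e ∈ F then false else ζ e).testBit i = false :=
      Nat.testBit_lt_two_pow (lt_of_lt_of_le (enc_lt _) (by norm_num at h2 ⊢; exact h2))
    rw [h1]
    simp

/-! ## From the point-mass sums to sub-mask sums -/

/-- `mixM` at a point mass cleared on the mask, through the bits. -/
lemma mixM_cfg_eq {k m j : ℕ} (hk : k &&& m = 0) :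
    mixM (cfg k) m (cfg j) = cfg (k ||| (j &&& m)) := by
  funext e
  have h : (k &&& m).testBit e.val = false := by rw [hk]; exact Nat.zero_testBit _
  rw [Nat.testBit_and] at h
  simp only [mixM, cfg, Nat.testBit_or, Nat.testBit_and]
  cases hm : m.testBit e.val <;> cases hkk : k.testBit e.val <;> simp_all

/-- `mixM` with the complementary colouring at a point mass cleared on the mask. -/
lemma mixM_cfg_not_eq {k m j : ℕ} (hk : k &&& m = 0) :
    mixM (cfg k) m (fun e => !cfg j e) = cfg (k ||| (m ^^^ (j &&& m))) := by
  funext e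
  have h : (k &&& m).testBit e.val = false := by rw [hk]; exact Nat.zero_testBit _
  rw [Nat.testBit_and] at h
  simp only [mixM, cfg, Nat.testBit_or, Nat.testBit_and, Nat.testBit_xor]
  cases hm : m.testBit e.val <;> cases hkk : k.testBit e.val <;> cases hj : j.testBit e.val <;>
    simp_all

/-- The two arguments of the sum are below `256`. -/
lemma args_lt {k m j : ℕ} (hk : k < 256) (hm : m < 256) :
    k ||| (j &&& m) < 256 ∧ k ||| (m ^^^ (j &&& m)) < 256 := by
  have hk' : k < 2 ^ 8 := by norm_num; exact hk
  have hm' : m < 2 ^ 8 := by norm_num; exact hm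
  have h1 : j &&& m < 2 ^ 8 := Nat.and_lt_two_pow j hm'
  have h2 : k ||| (j &&& m) < 2 ^ 8 := Nat.or_lt_two_pow hk' h1
  have h3 : k ||| (m ^^^ (j &&& m)) < 2 ^ 8 := Nat.or_lt_two_pow hk' (Nat.xor_lt_two_pow hm' h1)
  norm_num at h2 h3
  exact ⟨h2, h3⟩

/-- `W` as a sum of `xwT` over the bit patterns, at a point mass cleared on the mask. -/
lemma W_eq_sum_range (s y o u : Fin 6) {k m : ℕ} (hk : k < 256) (hm : m < 256)
    (hkm : k &&& m = 0) :
    W s y o u k m = ∑ j ∈ Finset.range 256,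
      xwT s y o u (k ||| (j &&& m)) (k ||| (m ^^^ (j &&& m))) := by
  unfold W
  rw [Finset.sum_range (fun j => xwT s y o u (k ||| (j &&& m)) (k ||| (m ^^^ (j &&& m))))]
  refine Finset.sum_congr rfl fun j _ => ?_
  rw [mixM_cfg_eq hkm, mixM_cfg_not_eq hkm, xwZ_cfg s y o u (args_lt hk hm).1 (args_lt hk hm).2]

/-- The size of the fibre of `0` under `j ↦ j &&& m` on the bit patterns of `Fin 256`. -/
def fib0 (m : ℕ) : ℕ := ((Finset.range 256).filter (fun j => j &&& m = 0)).card

/-- **The decided form**: the antipodal coefficient at the point mass `k` on the mask `m`, as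
`fib0 m` times the sum over the sub-masks `j'` of `m`. -/
def Wsub (s y o u : Fin 6) (k m : ℕ) : ℤ :=
  (fib0 m : ℤ) * ∑ j' ∈ (Finset.range 256).filter (fun j' => j' &&& (255 ^^^ m) = 0),
    xwT s y o u (k ||| j') (k ||| (m ^^^ j'))

/-- The fibre map lands in the sub-masks. -/
lemma land_mem {j m : ℕ} (hj : j < 256) (hm : m < 256) :
    j &&& m < 256 ∧ (j &&& m) &&& (255 ^^^ m) = 0 := by
  have hm' : m < 2 ^ 8 := by norm_num; exact hm
  have h1 : j &&& m < 2 ^ 8 := Nat.and_lt_two_pow j hm'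
  norm_num at h1
  refine ⟨h1, ?_⟩
  apply Nat.eq_of_testBit_eq
  intro i
  rw [Nat.testBit_and, Nat.testBit_and, Nat.testBit_xor, Nat.zero_testBit]
  by_cases hi : i < 8
  · have h255 : Nat.testBit 255 i = true := by
      have h := Nat.testBit_two_pow_sub_one 8 i
      norm_num at h
      rw [h]
      exact decide_eq_true hi
    rw [h255]
    cases m.testBit i <;> simp
  · have hj2 : j < 2 ^ i :=
      lt_of_lt_of_le (show j < 2 ^ 8 by norm_num; exact hj)
        (Nat.pow_le_pow_right (by norm_num) (by omega))
    rw [Nat.testBit_lt_two_pow hj2]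
    simp

/-- A sub-mask of `m` is absorbed by `m`. -/
lemma sub_and {j' m : ℕ} (hj' : j' < 256) (hsub : j' &&& (255 ^^^ m) = 0) : j' &&& m = j' := by
  apply Nat.eq_of_testBit_eq
  intro i
  rw [Nat.testBit_and]
  have h := congrArg (fun x => x.testBit i) hsub
  simp only [Nat.testBit_and, Nat.testBit_xor, Nat.zero_testBit] at h
  by_cases hi : i < 8
  · have h255 : Nat.testBit 255 i = true := by
      have h' := Nat.testBit_two_pow_sub_one 8 i
      norm_num at h'
      rw [h']
      exact decide_eq_true hi
    rw [h255] at h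
    cases hm : m.testBit i <;> cases hj : j'.testBit i <;> simp_all
  · have hj2 : j' < 2 ^ i :=
      lt_of_lt_of_le (show j' < 2 ^ 8 by norm_num; exact hj')
        (Nat.pow_le_pow_right (by norm_num) (by omega))
    rw [Nat.testBit_lt_two_pow hj2]
    simp

/-- Every fibre of `j ↦ j &&& m` over a sub-mask has the size of the fibre of `0`. -/
lemma card_fibre {m j' : ℕ} (hj' : j' < 256) (hsub : j' &&& (255 ^^^ m) = 0) :
    ((Finset.range 256).filter (fun j => j &&& m = j')).card = fib0 m := by
  unfold fib0
  have hj'2 : j' < 2 ^ 8 := by norm_num; exact hj'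
  have habs := sub_and hj' hsub
  refine Finset.card_nbij' (fun a => a ^^^ j') (fun b => b ^^^ j') ?_ ?_ ?_ ?_
  · intro a ha
    rw [Finset.mem_coe, Finset.mem_filter, Finset.mem_range] at ha ⊢
    refine ⟨?_, ?_⟩
    · have := Nat.xor_lt_two_pow (show a < 2 ^ 8 by norm_num; exact ha.1) hj'2
      norm_num at this
      exact this
    · rw [Nat.and_xor_distrib_right, ha.2, habs, Nat.xor_self]
  · intro b hb
    rw [Finset.mem_coe, Finset.mem_filter, Finset.mem_range] at hb ⊢
    refine ⟨?_, ?_⟩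
    · have := Nat.xor_lt_two_pow (show b < 2 ^ 8 by norm_num; exact hb.1) hj'2
      norm_num at this
      exact this
    · rw [Nat.and_xor_distrib_right, hb.2, habs, Nat.zero_xor]
  · intro a _
    simp only [Nat.xor_assoc, Nat.xor_self, Nat.xor_zero]
  · intro b _
    simp only [Nat.xor_assoc, Nat.xor_self, Nat.xor_zero]

/-- The sum over the bit patterns is the sub-mask sum. -/
lemma sum_range_eq_Wsub (s y o u : Fin 6) (k : ℕ) {m : ℕ} (hm : m < 256) :
    (∑ j ∈ Finset.range 256, xwT s y o u (k ||| (j &&& m)) (k ||| (m ^^^ (j &&& m)))) =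
      Wsub s y o u k m := by
  unfold Wsub
  rw [Finset.mul_sum, ← Finset.sum_fiberwise_of_maps_to (s := Finset.range 256)
    (t := (Finset.range 256).filter (fun j' => j' &&& (255 ^^^ m) = 0)) (g := fun j => j &&& m)
    (fun j hj => ?_)]
  · refine Finset.sum_congr rfl fun j' hj' => ?_
    rw [Finset.sum_congr rfl (g := fun _ => xwT s y o u (k ||| j') (k ||| (m ^^^ j')))
      (fun j hj => ?_), Finset.sum_const, nsmul_eq_mul]
    · rw [Finset.mem_filter, Finset.mem_range] at hj'
      rw [card_fibre hj'.1 hj'.2]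
    · rw [Finset.mem_filter] at hj
      rw [hj.2]
  · rw [Finset.mem_range] at hj
    obtain ⟨h1, h2⟩ := land_mem hj hm
    rw [Finset.mem_filter, Finset.mem_range]
    exact ⟨h1, h2⟩

/-! ## The decided sums at the placement `0, 1, 2, 3` -/

/-- The indicator of a Boolean, in `ℕ`. -/
def indN (b : Bool) : ℕ := if b then 1 else 0

/-- `indZ` is the cast of `indN`. -/
lemma indZ_eq (b : Bool) : indZ b = (indN b : ℤ) := by
  cases b <;> simp [indZ, indN]

/-- The positive part of `B_W` at two bit patterns, placement `s y o u = 0 1 2 3`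
(`a = 0 ↔ 3`, `λ = 1 ↔ 2`, `S = 0 ↔ 1`). -/
def termP (X Y : ℕ) : ℕ :=
  indN (tabBit X 0 3 && tabBit X 1 2) + indN (tabBit X 0 1 && tabBit X 0 3) * indN (tabBit Y 0 1 && tabBit Y 1 2)

/-- The negative part of `B_W` at two bit patterns, placement `0 1 2 3`. -/
def termN (X Y : ℕ) : ℕ :=
  indN (tabBit X 0 3) * indN (tabBit Y 1 2) + indN (tabBit X 0 1) * indN (tabBit Y 0 1 && tabBit Y 0 3 && tabBit Y 1 2)

/-- `xwT` at the placement `0, 1, 2, 3` is the difference of the two parts. -/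
lemma xwT_eq_terms (X Y : ℕ) : xwT 0 1 2 3 X Y = (termP X Y : ℤ) - termN X Y := by
  unfold xwT termP termN
  simp only [indZ_eq]
  push_cast
  ring

/-- The sub-masks of `m` among the bit patterns. -/
def subs (m : ℕ) : Finset ℕ := (Finset.range 256).filter (fun j' => j' &&& (255 ^^^ m) = 0)

/-- The positive sum of the antipodal coefficient at the placement `0, 1, 2, 3`. -/
def posSum (k m : ℕ) : ℕ := ∑ j' ∈ subs m, termP (k ||| j') (k ||| (m ^^^ j'))

/-- The negative sum of the antipodal coefficient at the placement `0, 1, 2, 3`. -/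
def negSum (k m : ℕ) : ℕ := ∑ j' ∈ subs m, termN (k ||| j') (k ||| (m ^^^ j'))

/-- `Wsub` at the placement `0, 1, 2, 3` is `fib0 m` times the difference of the two sums. -/
lemma Wsub_eq_sums (k m : ℕ) :
    Wsub 0 1 2 3 k m = (fib0 m : ℤ) * ((posSum k m : ℤ) - negSum k m) := by
  unfold Wsub posSum negSum subs
  refine congrArg (fun z => (fib0 m : ℤ) * z) ?_
  rw [Nat.cast_sum, Nat.cast_sum, ← Finset.sum_sub_distrib]
  exact Finset.sum_congr rfl fun j' _ => xwT_eq_terms _ _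

set_option maxHeartbeats 0 in
set_option maxRecDepth 100000 in
/-- **The `K_{2,4}` certificate (decided)**: at the placement `0, 1, 2, 3`, for each of the
`3^8 = 6561` cells (a point mass `k` cleared on the free mask `m`), the negative colouring sum is
at most the positive one — every antipodal coefficient is nonnegative.  One kernel `decide`
(`≈ 110 s` on the farm). -/
theorem sums_all : ∀ m < 256, ∀ k < 256, k &&& m = 0 → negSum k m ≤ posSum k m := by
  decide +kernel

/-- **Every antipodal coefficient at the placement `0, 1, 2, 3` is nonnegative.** -/
theorem xwAntiZ_nonneg (ζ : Config (Fin 8)) (F : Finset (Fin 8)) : 0 ≤ xwAntiZ 0 1 2 3 ζ F := by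
  rw [xwAntiZ_eq_erase, xwAntiZ_eq_W, W_eq_sum_range 0 1 2 3 (enc_lt _) (maskOf_lt F)
    (enc_erase_land ζ F), sum_range_eq_Wsub 0 1 2 3 _ (maskOf_lt F), Wsub_eq_sums]
  set K := enc (fun e => if e ∈ F then false else ζ e) with hK
  have hle : negSum K (maskOf F) ≤ posSum K (maskOf F) :=
    sums_all (maskOf F) (maskOf_lt F) K (enc_lt _) (enc_erase_land ζ F)
  have h1 : (0 : ℤ) ≤ (posSum K (maskOf F) : ℤ) - negSum K (maskOf F) := by
    rw [sub_nonneg]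
    exact_mod_cast hle
  exact mul_nonneg (Int.natCast_nonneg _) h1

end XWKTwoFour

end Summit.Ventures.PercRepro2
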